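/-
Copyright (c) 2026 The h413 squad. All rights reserved.
Released under Apache 2.0 license as described in the file LICENSE.
Authors: K2E3-p17 (g5) (road HC-14-ell, piece E3d∕E3e — centre reduction and the assembled statement)
-/
import Summits.HodgeConjecture.HodgeConjecture.Theorems.K2E3HC13LieZeroStretching   -- ★ (this seat): `hc13Lie_traceZero_of_forall_ne_zero` (Theorem 13 at the origin of `𝔰𝔲`, by stretching)
import HarnessLib

/-!
# K2_E3 road (h413), (SC-an) cone, road «HC-14-ell», piece E3d∕E3e: THE CENTRE OF `𝔲(3)` (HC1970 VI §1 Lemmas 26–27) AND THE ASSEMBLED STATEMENT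

Cell `pub/hodgecm-mathlib`, crux H413 = `stmt-HodgeConjecture-24833` (supports-only, `--as helper`), Track B «K2-LIT» engine E3, leaf (SC-an) ⟸ letter «HC-14-ell»
⟸ (E5) its Lie twin «HC13-Lie-ell» (cand `sig_K2E3HC13LieEllRankOne`, (SC-an) lead K2E3-p14 (g3)).  Harish-Chandra proves Theorem 13 for a REDUCTIVE `𝔤` by first
passing to the semisimple part ([HarishChandra1970] Part VI §1, Lemmas 26–27 p. 47: `𝔤 = 𝔷 ⊕ 𝔤₁`, orbits are translates along the centre) and then running the
`𝔤₀`-induction, whose last step at the origin (VI §7) is the sibling ★ `K2E3HC13LieZeroStretching.hc13Lie_traceZero_of_forall_ne_zero` — necessarily stated on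
`𝔰𝔲 = {X ∈ 𝔲 | tr X = 0}`: at a non-zero CENTRAL point `a·1` the `𝔤₀`-property is the whole theorem again (translate by `−a·1`), so the stretching hypothesis
«every non-zero point is good» is only dischargeable on the semisimple part.

THIS FILE: (§1) the centre reduction **`hc13Lie_of_traceZero`** — the Lie letter for ALL admissible `X ∈ 𝔲(σ,J)` (any compact `S`) from the letter for the
TRACE-ZERO admissible `X` (all compact `S'`): write `X = a·1 + X₁`, `a = tr X ∕ 3` (`σ a = −a` because `σ(tr X) = −tr X` on `𝔲` when `J` is invertible), so
`X₁ ∈ 𝔰𝔲`, `discr χ_{X₁} = discr χ_X` (★ `discr_sub_smul_one_fin_three`), `Z_U(X₁) = Z_U(X)`, `gXg⁻¹ = a·1 + gX₁g⁻¹`, and `Θ(gXg⁻¹) = Θ_a(gX₁g⁻¹)` with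
`Θ_a = Θ(a·1 + ·)` supported in the compact set `S̃ = {Z − (tr Z'∕3)·1 : Z, Z' ∈ S}`-type image (the trace of `X` is the trace of its conjugate in `S`, so `a`
ranges over a compact set); (§2) the ASSEMBLED statement **`hc13Lie_of_forall_ne_zero`**: IF every non-zero `X₀ ∈ 𝔰𝔲(σ,J)` is good (HC's `𝔤₁ ∖ {0} ⊆ 𝔤₀`,
Θ-form: window `V ∈ 𝓝 X₀` + constant for Borel `Θ ≤ M` supported in `V` and all trace-zero admissible `X`) THEN the Lie letter holds at every compact `S`
for all admissible `X` — the conclusion of the cand `sig_K2E3HC13LieEllRankOne` verbatim (any continuous `σ`, any `J` with `IsUnit J.det`, any measure `μ`).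
So the Lie letter (hence, through E5, the group letter and (SC-an)) needs EXACTLY the `𝔤₀`-statements at the non-zero points of `𝔰𝔲`: non-nilpotent
`X₀ = s + n` (`s ≠ 0` non-central semisimple: descent, pieces E2∕E4) and nilpotent `X₀ ≠ 0` (pieces E3a–c).

HONEST LABEL: `--supports stmt-HodgeConjecture-24833 --as helper`, count-neutral; HC_CM is proved only modulo the 7 printed citations (2 remaining named inputs:
hLiu418 = `stmt-HodgeConjecture-24832`, h413 = `stmt-HodgeConjecture-24833`) until rung 0 closes; (SC-an) and «HC-14-ell» are NOT proved here.

## References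
* [HarishChandra1970] Harish-Chandra (notes by G. van Dijk), *Harmonic Analysis on Reductive p-adic Groups*, LNM 162 (1970): Part VI §1 Lemmas 26–27 p. 47
  (reduction to the semisimple part), §2 p. 51 (`𝔤₀`), §7 pp. 59–60; Part V §3 Theorem 13 p. 44.
* [Rogawski1990] J. D. Rogawski, *Automorphic Representations of Unitary Groups in Three Variables*, Ann. of Math. Stud. 123 (1990), §7.3 p. 97.
* [Humphreys1972] J. E. Humphreys, *Introduction to Lie Algebras and Representation Theory*, GTM 9 (1972), §23.2 (centre invariance of the discriminant).
-/

set_option autoImplicit false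
set_option linter.dupNamespace false

noncomputable section

open MeasureTheory Measure Set Filter Topology Polynomial
open scoped NNReal ENNReal MatrixGroups WithZero
open Literature.NumberTheory.Automorphic Literature.NumberTheory.Automorphic.UnitaryGroup
open Literature.NumberTheory.GaloisRepresentations Literature.NumberTheory.GaloisRepresentations.IsNonarchimedeanLocalField

open Summit.HodgeConjecture.HodgeConjecture.Cruxes.H413.K2E3HC13LieStretchingKit
open Summit.HodgeConjecture.HodgeConjecture.Cruxes.H413.K2E3HC13LieZeroStretching

namespace Summit.HodgeConjecture.HodgeConjecture.Cruxes.H413.K2E3HC13LieCentreReduction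

variable {K : Type*} [Field K] [Valued K ℤᵐ⁰] [ValuativeRel K] [IsNonarchimedeanLocalField K]
  (σ : K →+* K) {J : Matrix (Fin 3) (Fin 3) K}

/-! ## §1 Algebra of the centre: `σ(tr X) = −tr X` on `𝔲`, `X − a·1 ∈ 𝔰𝔲`, invariants unchanged -/

omit [Valued K ℤᵐ⁰] [ValuativeRel K] [IsNonarchimedeanLocalField K] in
/-- On `𝔲(σ,J)` with `J` invertible the trace is `σ`-imaginary: `σ(tr X) = −tr X` (`X = −J⁻¹(σX)ᵀJ`). [cite: Rogawski1990, §1.9 p. 8] -/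
theorem map_trace_eq_neg (hJ : IsUnit J.det) {X : Matrix (Fin 3) (Fin 3) K} (hX : (X.map σ).transpose * J + J * X = 0) :
    σ (Matrix.trace X) = -Matrix.trace X := by
  have h1 : J * X = -((X.map σ).transpose * J) := eq_neg_of_add_eq_zero_right hX
  have h2 : X = J⁻¹ * -((X.map σ).transpose * J) := by
    rw [← h1, ← Matrix.mul_assoc, Matrix.nonsing_inv_mul J hJ, Matrix.one_mul]
  have h3 : Matrix.trace X = -Matrix.trace (X.map σ) := by
    conv_lhs => rw [h2]
    rw [Matrix.mul_neg, Matrix.trace_neg, ← Matrix.mul_assoc, Matrix.trace_mul_comm, ← Matrix.mul_assoc, Matrix.mul_nonsing_inv J hJ, Matrix.one_mul,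
      Matrix.trace_transpose]
  have h4 : Matrix.trace (X.map σ) = σ (Matrix.trace X) := by
    simp only [Matrix.trace, Matrix.diag_apply, Matrix.map_apply]
    exact (_root_.map_sum σ _ _).symm
  rw [← h4, h3, neg_neg]

omit [Valued K ℤᵐ⁰] [ValuativeRel K] [IsNonarchimedeanLocalField K] in
/-- A `σ`-imaginary scalar matrix lies in `𝔲`, so `X − a·1 ∈ 𝔲` for `X ∈ 𝔲` and `σ a = −a`. [cite: HarishChandra1970, Part VI §1 Lemma 27 p. 47] -/
theorem sub_smul_one_mem_lieU {a : K} (ha : σ a = -a) {X : Matrix (Fin 3) (Fin 3) K} (hX : (X.map σ).transpose * J + J * X = 0) :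
    ((X - a • (1 : Matrix (Fin 3) (Fin 3) K)).map σ).transpose * J + J * (X - a • (1 : Matrix (Fin 3) (Fin 3) K)) = 0 := by
  have hmap : (a • (1 : Matrix (Fin 3) (Fin 3) K)).map σ = σ a • (1 : Matrix (Fin 3) (Fin 3) K) := by
    ext i j
    by_cases h : i = j
    · subst h; simp
    · simp [Matrix.one_apply_ne h]
  rw [Matrix.map_sub _ (map_sub σ), hmap, ha, Matrix.transpose_sub, Matrix.transpose_smul, Matrix.transpose_one, Matrix.sub_mul, Matrix.mul_sub, Matrix.smul_mul,
    Matrix.mul_smul, Matrix.one_mul, Matrix.mul_one, neg_smul]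
  rw [show (X.map σ).transpose * J - -(a • J) + (J * X - a • J) = (X.map σ).transpose * J + J * X by abel, hX]

omit [Valued K ℤᵐ⁰] [ValuativeRel K] [IsNonarchimedeanLocalField K] in
/-- Conjugation fixes the centre: `g(X − a·1)g⁻¹ = gXg⁻¹ − a·1`. [cite: HarishChandra1970, Part VI §1 Lemma 27 p. 47] -/
theorem conj_sub_smul_one (g : ↥(unitaryGroupOfForm σ J)) (X : Matrix (Fin 3) (Fin 3) K) (a : K) :
    ((g : GL (Fin 3) K) : Matrix (Fin 3) (Fin 3) K) * (X - a • (1 : Matrix (Fin 3) (Fin 3) K)) * (((g : GL (Fin 3) K)⁻¹ : GL (Fin 3) K) : Matrix (Fin 3) (Fin 3) K) =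
      ((g : GL (Fin 3) K) : Matrix (Fin 3) (Fin 3) K) * X * (((g : GL (Fin 3) K)⁻¹ : GL (Fin 3) K) : Matrix (Fin 3) (Fin 3) K) - a • (1 : Matrix (Fin 3) (Fin 3) K) := by
  rw [Matrix.mul_sub, Matrix.sub_mul, Matrix.mul_smul, Matrix.mul_one, Matrix.smul_mul, Units.mul_inv]

omit [Valued K ℤᵐ⁰] [ValuativeRel K] [IsNonarchimedeanLocalField K] in
/-- `discr χ_{X − a·1} = discr χ_X` (★ `discr_sub_smul_one_fin_three`). [cite: Humphreys1972, §23.2] -/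
theorem charpoly_discr_sub_smul_one (X : Matrix (Fin 3) (Fin 3) K) (a : K) : (X - a • (1 : Matrix (Fin 3) (Fin 3) K)).charpoly.discr = X.charpoly.discr :=
  Literature.LinearAlgebra.Matrix.discr_sub_smul_one_fin_three X a

/-! ## §2 The centre reduction (HC Lemmas 26–27 for `𝔲 = 𝔷 ⊕ 𝔰𝔲`) -/

variable [MeasurableSpace ↥(unitaryGroupOfForm σ J)] [BorelSpace ↥(unitaryGroupOfForm σ J)] (μ : Measure ↥(unitaryGroupOfForm σ J))
  [MeasurableSpace (Matrix (Fin 3) (Fin 3) K)] [BorelSpace (Matrix (Fin 3) (Fin 3) K)]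

omit [BorelSpace ↥(unitaryGroupOfForm σ J)] in
/-- **THE CENTRE REDUCTION** ([HarishChandra1970] VI §1 Lemmas 26–27 in the letter's currency): the Lie letter at every compact `S` for ALL admissible `X ∈ 𝔲(σ,J)`
follows from the letter at every compact `S'` for the TRACE-ZERO admissible `X`.  `X = a·1 + X₁` with `a = tr X ∕ 3`: `X₁ ∈ 𝔰𝔲`, same discriminant, same
centraliser, `Θ(gXg⁻¹) = Θ(a·1 + gX₁g⁻¹)`; if the orbit of `X` meets `S` then `tr X ∈ tr(S)` (compact), so `Θ(a·1 + ·)` is supported in ONE compact set `S̃`.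
Needs `J` invertible (`σ(tr X) = −tr X`) and `CharZero` (division by `3`). [cite: HarishChandra1970, Part VI §1 Lemmas 26–27 p. 47] -/
theorem hc13Lie_of_traceZero [CharZero K] (hJ : IsUnit J.det)
    (h₀ : ∀ ⦃S' : Set (Matrix (Fin 3) (Fin 3) K)⦄, IsCompact S' →
      ∃ C : ℝ≥0, ∀ Θ : Matrix (Fin 3) (Fin 3) K → ℝ≥0∞, Measurable Θ → (∀ X, Θ X ≠ 0 → X ∈ S') → ∀ M : ℝ≥0∞, (∀ X, Θ X ≤ M) →
        ∀ X : Matrix (Fin 3) (Fin 3) K, (X.map σ).transpose * J + J * X = 0 → Matrix.trace X = 0 → X.charpoly.discr ≠ 0 →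
          IsCompact {g : ↥(unitaryGroupOfForm σ J) |
            ((g : GL (Fin 3) K) : Matrix (Fin 3) (Fin 3) K) * X * (((g : GL (Fin 3) K)⁻¹ : GL (Fin 3) K) : Matrix (Fin 3) (Fin 3) K) = X} →
            ((normAbs K X.charpoly.discr : ℝ≥0) : ℝ≥0∞) ^ (1 / 4 : ℝ) *
              ∫⁻ g, Θ (((g : GL (Fin 3) K) : Matrix (Fin 3) (Fin 3) K) * X * (((g : GL (Fin 3) K)⁻¹ : GL (Fin 3) K) : Matrix (Fin 3) (Fin 3) K)) ∂μ ≤ C * M)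
    {S : Set (Matrix (Fin 3) (Fin 3) K)} (hS : IsCompact S) :
    ∃ C : ℝ≥0, ∀ Θ : Matrix (Fin 3) (Fin 3) K → ℝ≥0∞, Measurable Θ → (∀ X, Θ X ≠ 0 → X ∈ S) → ∀ M : ℝ≥0∞, (∀ X, Θ X ≤ M) →
      ∀ X : Matrix (Fin 3) (Fin 3) K, (X.map σ).transpose * J + J * X = 0 → X.charpoly.discr ≠ 0 →
        IsCompact {g : ↥(unitaryGroupOfForm σ J) |
          ((g : GL (Fin 3) K) : Matrix (Fin 3) (Fin 3) K) * X * (((g : GL (Fin 3) K)⁻¹ : GL (Fin 3) K) : Matrix (Fin 3) (Fin 3) K) = X} →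
          ((normAbs K X.charpoly.discr : ℝ≥0) : ℝ≥0∞) ^ (1 / 4 : ℝ) *
            ∫⁻ g, Θ (((g : GL (Fin 3) K) : Matrix (Fin 3) (Fin 3) K) * X * (((g : GL (Fin 3) K)⁻¹ : GL (Fin 3) K) : Matrix (Fin 3) (Fin 3) K)) ∂μ ≤ C * M := by
  classical
  -- the compact set of translated supports
  have hcont : Continuous fun q : K × Matrix (Fin 3) (Fin 3) K => q.2 - ((3 : K)⁻¹ * q.1) • (1 : Matrix (Fin 3) (Fin 3) K) :=
    continuous_snd.sub ((continuous_const.mul continuous_fst).smul continuous_const)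
  have hT : IsCompact (Matrix.trace '' S) := hS.image continuous_id.matrix_trace
  have hSt : IsCompact ((fun q : K × Matrix (Fin 3) (Fin 3) K => q.2 - ((3 : K)⁻¹ * q.1) • (1 : Matrix (Fin 3) (Fin 3) K)) '' ((Matrix.trace '' S) ×ˢ S)) :=
    (hT.prod hS).image hcont
  obtain ⟨C, hC⟩ := h₀ hSt
  refine ⟨C, fun Θ hΘm hΘS M hM X hX hreg hcpt => ?_⟩
  by_cases hzero : ∀ g : ↥(unitaryGroupOfForm σ J),
      Θ (((g : GL (Fin 3) K) : Matrix (Fin 3) (Fin 3) K) * X * (((g : GL (Fin 3) K)⁻¹ : GL (Fin 3) K) : Matrix (Fin 3) (Fin 3) K)) = 0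
  · simp only [hzero, lintegral_zero, mul_zero, zero_le]
  push Not at hzero
  obtain ⟨g₀, hg₀⟩ := hzero
  -- the trace of `X` is the trace of its conjugate in `S`
  have htT : Matrix.trace X ∈ Matrix.trace '' S :=
    ⟨_, hΘS _ hg₀, Matrix.trace_units_conj (g₀ : GL (Fin 3) K) X⟩
  -- `X = a • 1 + X₁`, `X₁ ∈ 𝔰𝔲` with the same invariants
  set a : K := (3 : K)⁻¹ * Matrix.trace X with hadef
  set X₁ : Matrix (Fin 3) (Fin 3) K := X - a • (1 : Matrix (Fin 3) (Fin 3) K) with hX₁def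
  have hXa : X = a • (1 : Matrix (Fin 3) (Fin 3) K) + X₁ := by rw [hX₁def, add_sub_cancel]
  have hσa : σ a = -a := by
    rw [hadef, map_mul, map_inv₀, map_ofNat, map_trace_eq_neg σ hJ hX, mul_neg]
  have hX₁ : (X₁.map σ).transpose * J + J * X₁ = 0 := sub_smul_one_mem_lieU σ hσa hX
  have htr₁ : Matrix.trace X₁ = 0 := by
    rw [hX₁def, Matrix.trace_sub, Matrix.trace_smul, Matrix.trace_one, Fintype.card_fin, hadef, smul_eq_mul]
    have h3 : (3 : K) ≠ 0 := by norm_num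
    field_simp
    push_cast
    ring
  have hreg₁ : X₁.charpoly.discr ≠ 0 := by rw [hX₁def, charpoly_discr_sub_smul_one]; exact hreg
  have hcpt₁ : IsCompact {g : ↥(unitaryGroupOfForm σ J) |
      ((g : GL (Fin 3) K) : Matrix (Fin 3) (Fin 3) K) * X₁ * (((g : GL (Fin 3) K)⁻¹ : GL (Fin 3) K) : Matrix (Fin 3) (Fin 3) K) = X₁} := by
    have hset : {g : ↥(unitaryGroupOfForm σ J) |
        ((g : GL (Fin 3) K) : Matrix (Fin 3) (Fin 3) K) * X₁ * (((g : GL (Fin 3) K)⁻¹ : GL (Fin 3) K) : Matrix (Fin 3) (Fin 3) K) = X₁} =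
        {g : ↥(unitaryGroupOfForm σ J) |
          ((g : GL (Fin 3) K) : Matrix (Fin 3) (Fin 3) K) * X * (((g : GL (Fin 3) K)⁻¹ : GL (Fin 3) K) : Matrix (Fin 3) (Fin 3) K) = X} := by
      ext g
      simp only [Set.mem_setOf_eq, hX₁def, conj_sub_smul_one, sub_left_inj]
    rw [hset]
    exact hcpt
  -- the translated test function
  have hΘam : Measurable fun Y : Matrix (Fin 3) (Fin 3) K => Θ (a • (1 : Matrix (Fin 3) (Fin 3) K) + Y) :=
    hΘm.comp (continuous_const.add continuous_id).measurable
  have hΘaS : ∀ Y : Matrix (Fin 3) (Fin 3) K, Θ (a • (1 : Matrix (Fin 3) (Fin 3) K) + Y) ≠ 0 →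
      Y ∈ (fun q : K × Matrix (Fin 3) (Fin 3) K => q.2 - ((3 : K)⁻¹ * q.1) • (1 : Matrix (Fin 3) (Fin 3) K)) '' ((Matrix.trace '' S) ×ˢ S) := by
    intro Y hY
    refine ⟨(Matrix.trace X, a • (1 : Matrix (Fin 3) (Fin 3) K) + Y), Set.mk_mem_prod htT (hΘS _ hY), ?_⟩
    simp only [← hadef, add_sub_cancel_left]
  have hΘaM : ∀ Y : Matrix (Fin 3) (Fin 3) K, Θ (a • (1 : Matrix (Fin 3) (Fin 3) K) + Y) ≤ M := fun Y => hM _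
  -- pointwise `Θ(gXg⁻¹) = Θ_a(gX₁g⁻¹)` and equal weights
  have hpt : ∀ g : ↥(unitaryGroupOfForm σ J),
      Θ (((g : GL (Fin 3) K) : Matrix (Fin 3) (Fin 3) K) * X * (((g : GL (Fin 3) K)⁻¹ : GL (Fin 3) K) : Matrix (Fin 3) (Fin 3) K)) =
        Θ (a • (1 : Matrix (Fin 3) (Fin 3) K) +
          ((g : GL (Fin 3) K) : Matrix (Fin 3) (Fin 3) K) * X₁ * (((g : GL (Fin 3) K)⁻¹ : GL (Fin 3) K) : Matrix (Fin 3) (Fin 3) K)) := by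
    intro g
    rw [hX₁def, conj_sub_smul_one, add_sub_cancel]
  have hw : ((normAbs K X.charpoly.discr : ℝ≥0) : ℝ≥0∞) = ((normAbs K X₁.charpoly.discr : ℝ≥0) : ℝ≥0∞) := by
    rw [hX₁def, charpoly_discr_sub_smul_one]
  simp_rw [hpt, hw]
  exact hC _ hΘam hΘaS M hΘaM X₁ hX₁ htr₁ hreg₁ hcpt₁

/-! ## §3 THE ASSEMBLED STATEMENT: the Lie letter from `𝔰𝔲 ∖ {0} ⊆ 𝔤₀` -/

/-- **HARISH-CHANDRA'S THEOREM 13 FOR `𝔲(σ,J) ⊆ M₃(K)` FROM THE `𝔤₀`-STATEMENTS AT THE NON-ZERO POINTS OF `𝔰𝔲`** ([HarishChandra1970] VI §1 Lemmas 26–27 + §7,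
assembled; road HC-14-ell pieces E3d∕E3e).  HYPOTHESIS `hgood`: every `X₀ ∈ 𝔲(σ,J)` with `tr X₀ = 0`, `X₀ ≠ 0` has a window `V ∈ 𝓝 X₀` and a constant `C` with
`|discr χ_X|_K^{1∕4} · ∫_U Θ(gXg⁻¹) dμ ≤ C · M` for every Borel `Θ ≤ M` vanishing off `V` and every trace-zero admissible `X` (`X ∈ 𝔲`, `tr X = 0`, `discr χ_X ≠ 0`,
compact centraliser) — for `X₀ = s + n` non-nilpotent this is semisimple descent at `s ≠ 0` (HC Lemma 29; road pieces E2∕E4), for nilpotent `X₀ ≠ 0` it is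
HC's Lemma 38 (pieces E3a–c).  CONCLUSION: the conclusion of the Lie letter `sig_K2E3HC13LieEllRankOne` at the compact set `S`, bytes verbatim — for ANY
continuous `σ`, ANY `J` with `IsUnit J.det` (e.g. `Φ₃`), ANY measure `μ` on `U`.  Proof: ★ `hc13Lie_of_traceZero` ∘ ★ `hc13Lie_traceZero_of_forall_ne_zero`.
[cite: HarishChandra1970, Part V §3 Theorem 13 p. 44; Part VI §1 Lemmas 26–27 p. 47; Part VI §7 pp. 59–60] [cite: Rogawski1990, §7.3 p. 97] -/
theorem hc13Lie_of_forall_ne_zero [CharZero K] (hJ : IsUnit J.det) (hσc : Continuous σ)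
    (hgood : ∀ X₀ : Matrix (Fin 3) (Fin 3) K, X₀ ≠ 0 → (X₀.map σ).transpose * J + J * X₀ = 0 → Matrix.trace X₀ = 0 →
      ∃ V ∈ 𝓝 X₀, ∃ C : ℝ≥0, ∀ Θ : Matrix (Fin 3) (Fin 3) K → ℝ≥0∞, Measurable Θ → (∀ X, Θ X ≠ 0 → X ∈ V) → ∀ M : ℝ≥0∞, (∀ X, Θ X ≤ M) →
        ∀ X : Matrix (Fin 3) (Fin 3) K, (X.map σ).transpose * J + J * X = 0 → Matrix.trace X = 0 → X.charpoly.discr ≠ 0 →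
          IsCompact {g : ↥(unitaryGroupOfForm σ J) |
            ((g : GL (Fin 3) K) : Matrix (Fin 3) (Fin 3) K) * X * (((g : GL (Fin 3) K)⁻¹ : GL (Fin 3) K) : Matrix (Fin 3) (Fin 3) K) = X} →
            ((normAbs K X.charpoly.discr : ℝ≥0) : ℝ≥0∞) ^ (1 / 4 : ℝ) *
              ∫⁻ g, Θ (((g : GL (Fin 3) K) : Matrix (Fin 3) (Fin 3) K) * X * (((g : GL (Fin 3) K)⁻¹ : GL (Fin 3) K) : Matrix (Fin 3) (Fin 3) K)) ∂μ ≤ C * M)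
    {S : Set (Matrix (Fin 3) (Fin 3) K)} (hS : IsCompact S) :
    ∃ C : ℝ≥0, ∀ Θ : Matrix (Fin 3) (Fin 3) K → ℝ≥0∞, Measurable Θ → (∀ X, Θ X ≠ 0 → X ∈ S) → ∀ M : ℝ≥0∞, (∀ X, Θ X ≤ M) →
      ∀ X : Matrix (Fin 3) (Fin 3) K, (X.map σ).transpose * J + J * X = 0 → X.charpoly.discr ≠ 0 →
        IsCompact {g : ↥(unitaryGroupOfForm σ J) |
          ((g : GL (Fin 3) K) : Matrix (Fin 3) (Fin 3) K) * X * (((g : GL (Fin 3) K)⁻¹ : GL (Fin 3) K) : Matrix (Fin 3) (Fin 3) K) = X} →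
          ((normAbs K X.charpoly.discr : ℝ≥0) : ℝ≥0∞) ^ (1 / 4 : ℝ) *
            ∫⁻ g, Θ (((g : GL (Fin 3) K) : Matrix (Fin 3) (Fin 3) K) * X * (((g : GL (Fin 3) K)⁻¹ : GL (Fin 3) K) : Matrix (Fin 3) (Fin 3) K)) ∂μ ≤ C * M :=
  hc13Lie_of_traceZero σ μ hJ (fun _ hS' => hc13Lie_traceZero_of_forall_ne_zero σ μ hσc hgood hS') hS

end Summit.HodgeConjecture.HodgeConjecture.Cruxes.H413.K2E3HC13LieCentreReduction

end
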